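import Summits.Ventures.LatticeQCDFlow.Scoring.TorusAreaLaw2DIrreducible
import HarnessLib

/-!
# The exact non-abelian area law in two dimensions, V-f: WILSON LOOPS IN ANY NON-TRIVIAL IRREDUCIBLE REPRESENTATION `σ` CONFINE IN THE `ρ`-WILSON-ACTION THEORY

HONEST FRAMING: exact (Metropolis-corrected) sampling algorithms for lattice gauge theory;
figures of merit are autocorrelation/cost numbers at stated couplings and volumes; no
continuum-physics claim.

Venture `LatticeQCDFlow` (cell pub-lqcd), sub-topic `Scoring`; FANOUT row 5 (`s0-sun-a`), GEN-18.
NEW WORK of the cell (placement rule).  Parts V-c/V-d/V-e bound the Wilson loop `N⁻¹ Re tr ρ(W)` in the SAME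
representation `ρ` that defines the Wilson action (`HasAreaLaw 2 ρ β`).  Part V-c's engine
(`abs_ratio_loop_le`) is stated for an arbitrary continuous class weight, so the observable's representation
may differ from the action's.  Here `ρ : G → M_N(ℂ)` defines the measure (`wilsonMeasure ρ β`, weight
`e^{−β Σ_p (N − Re tr ρ(U_p))}`) and `σ : G → M_M(ℂ)` is the representation of the loop
(`wilsonLoop σ = M⁻¹ Re tr σ(W)`) — e.g. adjoint or higher loops in the fundamental-action theory:

* `abs_wilsonExpectation_loop_le_of_rep` — the torus bound `|⟨W^σ_{R×T}⟩_{ρ,L,β}| ≤ (‖c‖/m)^{RT} + K q^{2RT}`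
  uniformly in `L`, for a scalar `σ`-one-plaquette matrix `∫ σ(g) e^{−β(N−Re tr ρ(g))} dg = c·1`;
* `areaLaw_two_of_rep_scalar` — hence constants `C`, `c_area > 0` with
  `|⟨W^σ_{R×T}⟩_{ρ,(ℤ/L)²,β}| ≤ C^{2(R+T)} e^{−c_area RT}` for all `L`, planes, base points, `1 ≤ R, T ≤ L/2`,
  as soon as `‖c‖ < m = ∫ e^{−β(N−Re tr ρ)}`;
* `areaLaw_two_of_rep_isIrreducibleFamily` — the same for EVERY continuous `σ` with trivial commutant and some
  `‖tr σ(g₀)‖ < M` (Schur: the `σ`-one-plaquette matrix commutes with `σ`);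
* `areaLaw_two_of_rep_trace_re_lt`, `areaLaw_two_of_rep_card_eq_one` — the real-scalar and the character
  (`M = 1`, `σ ≠ 1`) cases; `areaLaw_two_of_rep_irreducible'` — all `M ≥ 1`: trivial commutant and `σ ≠ 1`;
* **`areaLaw_two_of_rep_irreducible`** — EVERY continuous `σ` of dimension `M ≥ 2` with trivial commutant (every
  irreducible `σ`, `M ≥ 2`), EVERY continuous `ρ`, EVERY real `β`: the `σ`-Wilson loops of the two-dimensional
  `ρ`-Wilson-action lattice gauge theory obey the volume-uniform area law.

No `def`, nothing cited as a fact, 0 sorry.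
-/

noncomputable section

open MeasureTheory Function Finset
open scoped Matrix
open Literature.MathematicalPhysics.QuantumFieldTheory
open Literature.MathematicalPhysics.QuantumLattice
open Literature.RepresentationTheory.CompactGroups
open Summit.Ventures.LatticeQCDFlow.Theory2.Lattice
open Summit.Ventures.LatticeQCDFlow.Theory2.Lattice.TwoDim

namespace Summit.Ventures.LatticeQCDFlow.Scoring

section General

variable {G : Type*} [Group G] [TopologicalSpace G] [IsTopologicalGroup G]
  [CompactSpace G] [SecondCountableTopology G] [MeasurableSpace G] [BorelSpace G] {N M : ℕ}
  (ρ : G →* Matrix (Fin N) (Fin N) ℂ) (σ : G →* Matrix (Fin M) (Fin M) ℂ)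

/-- **THE TORUS BOUND FOR A `σ`-LOOP IN THE `ρ`-THEORY.**  For continuous `ρ`, `σ` with `|Re tr ρ| ≤ B`,
`|Re tr σ| ≤ B'` and a scalar `σ`-one-plaquette matrix `∫ σ(g)_{kl} e^{−β(N − Re tr ρ(g))} dg = c δ_{kl}`:
with `c₀ = e^{−|β|(N+B)}`, `s₁ = e^{|β|(N+B)}`, `m = ∫ e^{−β(N − Re tr ρ)} dHaar`, for every `L`, corner `x` and
`R × T` loop with `1 ≤ R, T`, `2R ≤ L`, `2T ≤ L`:
`|⟨W^σ_{R×T}⟩_{ρ,L,β}| ≤ (‖c‖/m)^{RT} + (B' s₁/(M c₀)) (1 − c₀/m)^{2RT}`. -/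
theorem abs_wilsonExpectation_loop_le_of_rep [NeZero M] (hρ : Continuous ρ) (hσ : Continuous σ) (β : ℝ)
    {B : ℝ} (hB : ∀ g : G, |(ρ g).trace.re| ≤ B)
    {B' : ℝ} (hB'0 : 0 ≤ B') (hB' : ∀ g : G, |(σ g).trace.re| ≤ B') {c : ℂ}
    (hM : (Matrix.of fun k l : Fin M => ∫ g, σ g k l *
      (Real.exp (-(β * ((N : ℝ) - (ρ g).trace.re))) : ℂ) ∂(haarProbability G)) =
        c • (1 : Matrix (Fin M) (Fin M) ℂ))
    {L : ℕ} [NeZero L] (hL : 2 ≤ L) (x : Site 2 L) {R T : ℕ} (hR1 : 1 ≤ R) (hT1 : 1 ≤ T)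
    (h2R : 2 * R ≤ L) (h2T : 2 * T ≤ L) :
    |wilsonExpectation ρ β (wilsonLoop σ x 0 1 R T)| ≤
      (‖c‖ / ∫ g, Real.exp (-(β * ((N : ℝ) - (ρ g).trace.re))) ∂(haarProbability G)) ^ (R * T) +
        B' / M * Real.exp (|β| * (N + B)) / Real.exp (-(|β| * (N + B))) *
          (1 - Real.exp (-(|β| * (N + B))) /
            ∫ g, Real.exp (-(β * ((N : ℝ) - (ρ g).trace.re))) ∂(haarProbability G)) ^ (2 * (R * T)) := by
  have hw : Continuous fun g : G => Real.exp (-(β * ((N : ℝ) - (ρ g).trace.re))) := by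
    have := Complex.continuous_re.comp hρ.matrix_trace
    fun_prop
  have hwc : ∀ k g : G, Real.exp (-(β * ((N : ℝ) - (ρ (k * g * k⁻¹)).trace.re))) =
      Real.exp (-(β * ((N : ℝ) - (ρ g).trace.re))) := fun k g => by
    rw [map_mul, map_mul, Matrix.trace_mul_cycle, ← map_mul, inv_mul_cancel, map_one, one_mul]
  have hbound : ∀ g : G, |β * ((N : ℝ) - (ρ g).trace.re)| ≤ |β| * (N + B) := fun g => by
    rw [abs_mul]
    refine mul_le_mul_of_nonneg_left ?_ (abs_nonneg β)
    have h2 : |((N : ℝ) - (ρ g).trace.re)| ≤ |(N : ℝ)| + |(ρ g).trace.re| := abs_sub _ _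
    rw [Nat.abs_cast] at h2
    linarith [hB g]
  have hwlo : ∀ g : G, Real.exp (-(|β| * (N + B))) ≤ Real.exp (-(β * ((N : ℝ) - (ρ g).trace.re))) :=
    fun g => Real.exp_le_exp.mpr (by linarith [(abs_le.mp (hbound g)).2])
  have hwhi : ∀ g : G, Real.exp (-(β * ((N : ℝ) - (ρ g).trace.re))) ≤ Real.exp (|β| * (N + B)) :=
    fun g => Real.exp_le_exp.mpr (by linarith [(abs_le.mp (hbound g)).1])
  rw [wilsonExpectation_two_eq_div ρ hρ β]
  have h := abs_ratio_loop_le σ hσ hB'0 hB' hw hwc (Real.exp_pos _) hwlo hwhi hM hL x hR1 hT1 h2R h2T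
  simpa only [div_eq_mul_inv, mul_assoc] using h

/-- **AREA LAW FOR `σ`-LOOPS IN THE `ρ`-THEORY FROM A SCALAR `σ`-ONE-PLAQUETTE MATRIX.**  If
`∫ σ(g) e^{−β(N − Re tr ρ(g))} dg = c·1` with `‖c‖ < ∫ e^{−β(N − Re tr ρ)}`, there are `C` and `c_area > 0` with
`|⟨W^σ_{R×T}⟩_{ρ,(ℤ/L)²,β}| ≤ C^{2(R+T)} e^{−c_area RT}` for every `L`, both planes, every base point and all
`1 ≤ R, T ≤ L/2` (the shape of `HasAreaLaw`, with the loop in the representation `σ`). -/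
theorem areaLaw_two_of_rep_scalar [NeZero M] (hρ : Continuous ρ) (hσ : Continuous σ) (β : ℝ) {c : ℂ}
    (hM : (Matrix.of fun k l : Fin M => ∫ g, σ g k l *
      (Real.exp (-(β * ((N : ℝ) - (ρ g).trace.re))) : ℂ) ∂(haarProbability G)) =
        c • (1 : Matrix (Fin M) (Fin M) ℂ))
    (hc : ‖c‖ < ∫ g, Real.exp (-(β * ((N : ℝ) - (ρ g).trace.re))) ∂(haarProbability G)) :
    ∃ C c_area : ℝ, 0 < c_area ∧ ∀ (L : ℕ) [NeZero L] (x : Site 2 L) (i j : Fin 2) (R T : ℕ), i ≠ j →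
      1 ≤ R → 1 ≤ T → 2 * R ≤ L → 2 * T ≤ L →
        |wilsonExpectation ρ β (wilsonLoop σ x i j R T)| ≤ C ^ (2 * (R + T)) * Real.exp (-c_area * (R * T)) := by
  obtain ⟨B, -, hB⟩ := exists_bound_trace_re_nonneg ρ hρ
  obtain ⟨B', hB'0, hB'⟩ := exists_bound_trace_re_nonneg σ hσ
  have hw : Continuous fun g : G => Real.exp (-(β * ((N : ℝ) - (ρ g).trace.re))) := by
    have := Complex.continuous_re.comp hρ.matrix_trace
    fun_prop
  have hbound : ∀ g : G, |β * ((N : ℝ) - (ρ g).trace.re)| ≤ |β| * (N + B) := fun g => by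
    rw [abs_mul]
    refine mul_le_mul_of_nonneg_left ?_ (abs_nonneg β)
    have h2 : |((N : ℝ) - (ρ g).trace.re)| ≤ |(N : ℝ)| + |(ρ g).trace.re| := abs_sub _ _
    rw [Nat.abs_cast] at h2
    linarith [hB g]
  have hwlo : ∀ g : G, Real.exp (-(|β| * (N + B))) ≤ Real.exp (-(β * ((N : ℝ) - (ρ g).trace.re))) :=
    fun g => Real.exp_le_exp.mpr (by linarith [(abs_le.mp (hbound g)).2])
  set m : ℝ := ∫ g, Real.exp (-(β * ((N : ℝ) - (ρ g).trace.re))) ∂(haarProbability G) with hm_def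
  set c₀ : ℝ := Real.exp (-(|β| * (N + B))) with hc₀_def
  set s₁ : ℝ := Real.exp (|β| * (N + B)) with hs₁_def
  have hc₀ : 0 < c₀ := Real.exp_pos _
  have hm_pos : 0 < m := lt_of_le_of_lt (norm_nonneg c) hc
  have hm_lo : c₀ ≤ m := by
    have h : ∫ _g : G, c₀ ∂(haarProbability G) ≤ m :=
      integral_mono (integrable_const c₀) (integrable_haarProbability_of_continuous hw) hwlo
    simpa using h
  set P : ℝ := ‖c‖ / m with hP_def
  set q : ℝ := (1 - c₀ / m) ^ 2 with hq_def
  set K : ℝ := B' / M * s₁ / c₀ with hK_def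
  set θ : ℝ := max (max P q) (1 / 2) with hθ_def
  have hP0 : 0 ≤ P := div_nonneg (norm_nonneg c) hm_pos.le
  have hP1 : P < 1 := (div_lt_one hm_pos).mpr hc
  have hq0 : 0 ≤ q := sq_nonneg _
  have hq1 : q < 1 := by
    rw [hq_def, sq_lt_one_iff₀ (by rw [sub_nonneg]; exact (div_le_one hm_pos).mpr hm_lo)]
    have : 0 < c₀ / m := div_pos hc₀ hm_pos
    linarith
  have hθpos : 0 < θ := lt_of_lt_of_le (by norm_num) (le_max_right _ _)
  have hθ1 : θ < 1 := max_lt (max_lt hP1 hq1) (by norm_num)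
  have hK0 : 0 ≤ K := by positivity
  refine ⟨1 + K, -Real.log θ, neg_pos.mpr (Real.log_neg hθpos hθ1), ?_⟩
  intro L _ x i j R T hij hR1 hT1 h2R h2T
  have hL : 2 ≤ L := by omega
  have key : ∀ R T : ℕ, 1 ≤ R → 1 ≤ T → 2 * R ≤ L → 2 * T ≤ L →
      |wilsonExpectation ρ β (wilsonLoop σ x 0 1 R T)| ≤ (1 + K) ^ (2 * (R + T)) *
        Real.exp (-(-Real.log θ) * ((R : ℝ) * (T : ℝ))) := by
    intro R T hR1 hT1 h2R h2T
    have h := abs_wilsonExpectation_loop_le_of_rep ρ σ hρ hσ β hB hB'0 hB' hM hL x hR1 hT1 h2R h2T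
    have hexp : Real.exp (-(-Real.log θ) * ((R : ℝ) * (T : ℝ))) = θ ^ (R * T) := by
      rw [neg_neg, ← Nat.cast_mul, mul_comm, Real.exp_nat_mul, Real.exp_log hθpos]
    rw [hexp]
    have hPθ : P ^ (R * T) ≤ θ ^ (R * T) :=
      pow_le_pow_left₀ hP0 ((le_max_left _ _).trans (le_max_left _ _)) _
    have hqθ : (1 - c₀ / m) ^ (2 * (R * T)) ≤ θ ^ (R * T) := by
      rw [pow_mul]
      exact pow_le_pow_left₀ hq0 ((le_max_right _ _).trans (le_max_left _ _)) _
    have hC : (1 + K) ≤ (1 + K) ^ (2 * (R + T)) := le_self_pow₀ (by linarith) (by omega)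
    calc |wilsonExpectation ρ β (wilsonLoop σ x 0 1 R T)|
        ≤ P ^ (R * T) + K * (1 - c₀ / m) ^ (2 * (R * T)) := h
      _ ≤ θ ^ (R * T) + K * θ ^ (R * T) := add_le_add hPθ (mul_le_mul_of_nonneg_left hqθ hK0)
      _ = (1 + K) * θ ^ (R * T) := by ring
      _ ≤ (1 + K) ^ (2 * (R + T)) * θ ^ (R * T) :=
          mul_le_mul_of_nonneg_right hC (pow_nonneg hθpos.le _)
  have h01 : ∀ k : Fin 2, k = 0 ∨ k = 1 := by decide
  rcases h01 i with rfl | rfl <;> rcases h01 j with rfl | rfl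
  · exact absurd rfl hij
  · exact key R T hR1 hT1 h2R h2T
  · rw [show wilsonLoop σ x 1 0 R T = wilsonLoop σ x 0 1 T R from
        funext fun U => wilsonLoop_one_zero σ hσ x R T U,
      show 2 * (R + T) = 2 * (T + R) by ring, show (R : ℝ) * T = T * R by ring]
    exact key T R hT1 hR1 h2T h2R
  · exact absurd rfl hij

/-- **AREA LAW FOR `σ`-LOOPS IN THE `ρ`-THEORY, `σ` WITH TRIVIAL COMMUTANT.**  For continuous `ρ`, `σ` with
`IsIrreducibleFamily σ` and some `‖tr σ(g₀)‖ < M`, and every real `β`: the `σ`-one-plaquette matrix for the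
`ρ`-Wilson weight commutes with `σ` (the weight is a class function), hence is a scalar `c·1` with
`M c = ∫ tr σ · w`, and `‖∫ tr σ · w‖ ≤ ∫ ‖tr σ‖ w < M ∫ w`. -/
theorem areaLaw_two_of_rep_isIrreducibleFamily [NeZero M] (hρ : Continuous ρ) (hσ : Continuous σ)
    (hirr : IsIrreducibleFamily fun g : G => σ g) (hlt : ∃ g₀ : G, ‖(σ g₀).trace‖ < M) (β : ℝ) :
    ∃ C c_area : ℝ, 0 < c_area ∧ ∀ (L : ℕ) [NeZero L] (x : Site 2 L) (i j : Fin 2) (R T : ℕ), i ≠ j →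
      1 ≤ R → 1 ≤ T → 2 * R ≤ L → 2 * T ≤ L →
        |wilsonExpectation ρ β (wilsonLoop σ x i j R T)| ≤ C ^ (2 * (R + T)) * Real.exp (-c_area * (R * T)) := by
  obtain ⟨g₀, hg₀⟩ := hlt
  have hMpos : (0 : ℝ) < M := Nat.cast_pos.mpr (NeZero.pos M)
  have htrc : Continuous fun g : G => (σ g).trace := hσ.matrix_trace
  have hw : Continuous fun g : G => Real.exp (-(β * ((N : ℝ) - (ρ g).trace.re))) := by
    have := Complex.continuous_re.comp hρ.matrix_trace
    fun_prop
  have hwc : ∀ k g : G, Real.exp (-(β * ((N : ℝ) - (ρ (k * g * k⁻¹)).trace.re))) =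
      Real.exp (-(β * ((N : ℝ) - (ρ g).trace.re))) := fun k g => by
    rw [map_mul, map_mul, Matrix.trace_mul_cycle, ← map_mul, inv_mul_cancel, map_one, one_mul]
  obtain ⟨c, hc⟩ := hirr (Matrix.of fun k l : Fin M => ∫ g, σ g k l *
      (Real.exp (-(β * ((N : ℝ) - (ρ g).trace.re))) : ℂ) ∂(haarProbability G))
    (fun g => (rep_mul_integralMatrix_comm σ hσ hw hwc g).symm)
  refine areaLaw_two_of_rep_scalar ρ σ hρ hσ β hc ?_
  have hint : ∀ k : Fin M, Integrable (fun g : G => σ g k k *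
      (Real.exp (-(β * ((N : ℝ) - (ρ g).trace.re))) : ℂ)) (haarProbability G) := fun k =>
    integrable_haarProbability_of_continuous ((hσ.matrix_elem k k).mul (Complex.continuous_ofReal.comp hw))
  have hMtrace : (Matrix.of fun k l : Fin M => ∫ g, σ g k l *
      (Real.exp (-(β * ((N : ℝ) - (ρ g).trace.re))) : ℂ) ∂(haarProbability G)).trace =
      ∫ g, (σ g).trace * (Real.exp (-(β * ((N : ℝ) - (ρ g).trace.re))) : ℂ) ∂(haarProbability G) := by
    symm
    calc ∫ g, (σ g).trace * (Real.exp (-(β * ((N : ℝ) - (ρ g).trace.re))) : ℂ) ∂(haarProbability G)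
        = ∫ g, ∑ k, σ g k k * (Real.exp (-(β * ((N : ℝ) - (ρ g).trace.re))) : ℂ) ∂(haarProbability G) := by
          refine integral_congr_ae (ae_of_all _ fun g => ?_)
          simp only [Matrix.trace, Matrix.diag_apply, Finset.sum_mul]
      _ = ∑ k, ∫ g, σ g k k * (Real.exp (-(β * ((N : ℝ) - (ρ g).trace.re))) : ℂ) ∂(haarProbability G) :=
          integral_finsetSum _ fun k _ => hint k
      _ = _ := by simp only [Matrix.trace, Matrix.diag_apply, Matrix.of_apply]
  have hcM : c * (M : ℂ) = ∫ g, (σ g).trace * (Real.exp (-(β * ((N : ℝ) - (ρ g).trace.re))) : ℂ)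
      ∂(haarProbability G) := by
    have h := congrArg Matrix.trace hc
    rw [hMtrace, Matrix.trace_smul, Matrix.trace_one, Fintype.card_fin, smul_eq_mul] at h
    exact h.symm
  have hle : ∀ g : G, ‖(σ g).trace‖ ≤ M := norm_trace_le_card σ hσ
  have hnorm : ‖∫ g, (σ g).trace * (Real.exp (-(β * ((N : ℝ) - (ρ g).trace.re))) : ℂ) ∂(haarProbability G)‖ ≤
      ∫ g, ‖(σ g).trace‖ * Real.exp (-(β * ((N : ℝ) - (ρ g).trace.re))) ∂(haarProbability G) := by
    refine (norm_integral_le_integral_norm _).trans_eq (integral_congr_ae (ae_of_all _ fun g => ?_))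
    simp only [norm_mul, Complex.norm_real, Real.norm_eq_abs, abs_of_pos (Real.exp_pos _)]
  have hpos : 0 < ∫ g, ((M : ℝ) - ‖(σ g).trace‖) * Real.exp (-(β * ((N : ℝ) - (ρ g).trace.re)))
      ∂(haarProbability G) := by
    refine Continuous.integral_pos_of_hasCompactSupport_nonneg_nonzero (x := g₀)
      ((continuous_const.sub htrc.norm).mul hw) (HasCompactSupport.of_compactSpace _)
      (fun g => mul_nonneg (by linarith [hle g]) (Real.exp_pos _).le) ?_
    exact mul_ne_zero (by linarith) (Real.exp_pos _).ne'
  have hwi : Integrable (fun g : G => Real.exp (-(β * ((N : ℝ) - (ρ g).trace.re)))) (haarProbability G) :=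
    integrable_haarProbability_of_continuous hw
  have hsplit : ∫ g, ((M : ℝ) - ‖(σ g).trace‖) * Real.exp (-(β * ((N : ℝ) - (ρ g).trace.re)))
      ∂(haarProbability G) =
      M * (∫ g, Real.exp (-(β * ((N : ℝ) - (ρ g).trace.re))) ∂(haarProbability G)) -
        ∫ g, ‖(σ g).trace‖ * Real.exp (-(β * ((N : ℝ) - (ρ g).trace.re))) ∂(haarProbability G) := by
    have hni : Integrable (fun g : G => ‖(σ g).trace‖ * Real.exp (-(β * ((N : ℝ) - (ρ g).trace.re))))
        (haarProbability G) :=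
      integrable_haarProbability_of_continuous (htrc.norm.mul hw)
    simp_rw [sub_mul]
    rw [integral_sub (hwi.const_mul _) hni, integral_const_mul]
  rw [hsplit] at hpos
  have hlt' : ‖c‖ * M < (∫ g, Real.exp (-(β * ((N : ℝ) - (ρ g).trace.re))) ∂(haarProbability G)) * M := by
    calc ‖c‖ * M = ‖c * (M : ℂ)‖ := by rw [norm_mul, Complex.norm_natCast]
      _ ≤ ∫ g, ‖(σ g).trace‖ * Real.exp (-(β * ((N : ℝ) - (ρ g).trace.re))) ∂(haarProbability G) := by
          rw [hcM]; exact hnorm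
      _ < (∫ g, Real.exp (-(β * ((N : ℝ) - (ρ g).trace.re))) ∂(haarProbability G)) * M := by linarith
  exact lt_of_mul_lt_mul_right hlt' hMpos.le

/-- **EVERY IRREDUCIBLE `σ` OF DIMENSION `≥ 2` CONFINES IN EVERY TWO-DIMENSIONAL `ρ`-WILSON-ACTION THEORY AT
EVERY COUPLING.**  For a compact second-countable `G`, continuous representations `ρ : G → M_N(ℂ)` (the action)
and `σ : G → M_M(ℂ)`, `M ≥ 2`, with trivial commutant (every irreducible `σ`; e.g. the adjoint representation of
`SU(N)` in the fundamental-action theory), and every real `β`: there are `C` and `c_area > 0` with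
`|⟨M⁻¹ Re tr σ(W_{R×T})⟩_{ρ,(ℤ/L)²,β}| ≤ C^{2(R+T)} e^{−c_area RT}` for every `L`, both planes, every base
point and all `1 ≤ R, T ≤ L/2`. -/
theorem areaLaw_two_of_rep_irreducible (hM2 : 2 ≤ M) (hρ : Continuous ρ) (hσ : Continuous σ)
    (hirr : IsIrreducibleFamily fun g : G => σ g) (β : ℝ) :
    ∃ C c_area : ℝ, 0 < c_area ∧ ∀ (L : ℕ) [NeZero L] (x : Site 2 L) (i j : Fin 2) (R T : ℕ), i ≠ j →
      1 ≤ R → 1 ≤ T → 2 * R ≤ L → 2 * T ≤ L →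
        |wilsonExpectation ρ β (wilsonLoop σ x i j R T)| ≤ C ^ (2 * (R + T)) * Real.exp (-c_area * (R * T)) := by
  haveI : NeZero M := ⟨by omega⟩
  exact areaLaw_two_of_rep_isIrreducibleFamily ρ σ hρ hσ hirr
    (exists_norm_trace_lt_of_isIrreducibleFamily σ hM2 hσ hirr) β

/-- **AREA LAW FOR `σ`-LOOPS FROM A REAL SCALAR.**  If the `σ`-one-plaquette matrix for the `ρ`-Wilson weight is
the real scalar `(M⁻¹ ∫ Re tr σ · e^{−β(N − Re tr ρ)})·1` and some `Re tr σ(g₀) < M`, the `σ`-loops of the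
`ρ`-theory obey the volume-uniform area law (`M ± Re tr σ > 0` at `g = 1`, resp. `g₀`; Haar charges open sets). -/
theorem areaLaw_two_of_rep_trace_re_lt [NeZero M] (hρ : Continuous ρ) (hσ : Continuous σ) (β : ℝ)
    (hM : (Matrix.of fun k l : Fin M => ∫ g, σ g k l *
      (Real.exp (-(β * ((N : ℝ) - (ρ g).trace.re))) : ℂ) ∂(haarProbability G)) =
        (((M : ℝ)⁻¹ * ∫ g, (σ g).trace.re * Real.exp (-(β * ((N : ℝ) - (ρ g).trace.re)))
          ∂(haarProbability G) : ℝ) : ℂ) • (1 : Matrix (Fin M) (Fin M) ℂ))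
    (hlt : ∃ g₀ : G, (σ g₀).trace.re < M) :
    ∃ C c_area : ℝ, 0 < c_area ∧ ∀ (L : ℕ) [NeZero L] (x : Site 2 L) (i j : Fin 2) (R T : ℕ), i ≠ j →
      1 ≤ R → 1 ≤ T → 2 * R ≤ L → 2 * T ≤ L →
        |wilsonExpectation ρ β (wilsonLoop σ x i j R T)| ≤ C ^ (2 * (R + T)) * Real.exp (-c_area * (R * T)) := by
  refine areaLaw_two_of_rep_scalar ρ σ hρ hσ β hM ?_
  rw [Complex.norm_real, Real.norm_eq_abs]
  obtain ⟨g₀, hg₀⟩ := hlt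
  have hMpos : (0 : ℝ) < M := Nat.cast_pos.mpr (NeZero.pos M)
  have htr : Continuous fun g : G => (σ g).trace.re := Complex.continuous_re.comp hσ.matrix_trace
  have hw : Continuous fun g : G => Real.exp (-(β * ((N : ℝ) - (ρ g).trace.re))) := by
    have := Complex.continuous_re.comp hρ.matrix_trace
    fun_prop
  have hle : ∀ g : G, |(σ g).trace.re| ≤ M := fun g => by
    simpa using CompactGroup.abs_re_trace_le_card σ hσ g
  have hplus : 0 < ∫ g, ((M : ℝ) + (σ g).trace.re) * Real.exp (-(β * ((N : ℝ) - (ρ g).trace.re)))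
      ∂(haarProbability G) := by
    refine Continuous.integral_pos_of_hasCompactSupport_nonneg_nonzero (x := 1)
      ((continuous_const.add htr).mul hw) (HasCompactSupport.of_compactSpace _)
      (fun g => mul_nonneg (by linarith [neg_abs_le ((σ g).trace.re), hle g]) (Real.exp_pos _).le) ?_
    have h1 : (σ 1).trace.re = M := by
      rw [map_one, Matrix.trace_one, Fintype.card_fin, Complex.natCast_re]
    rw [h1]
    exact mul_ne_zero (by linarith) (Real.exp_pos _).ne'
  have hminus : 0 < ∫ g, ((M : ℝ) - (σ g).trace.re) * Real.exp (-(β * ((N : ℝ) - (ρ g).trace.re)))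
      ∂(haarProbability G) := by
    refine Continuous.integral_pos_of_hasCompactSupport_nonneg_nonzero (x := g₀)
      ((continuous_const.sub htr).mul hw) (HasCompactSupport.of_compactSpace _)
      (fun g => mul_nonneg (by linarith [le_abs_self ((σ g).trace.re), hle g]) (Real.exp_pos _).le) ?_
    exact mul_ne_zero (by linarith) (Real.exp_pos _).ne'
  have hwi : Integrable (fun g : G => Real.exp (-(β * ((N : ℝ) - (ρ g).trace.re)))) (haarProbability G) :=
    integrable_haarProbability_of_continuous hw
  have htwi : Integrable (fun g : G => (σ g).trace.re * Real.exp (-(β * ((N : ℝ) - (ρ g).trace.re))))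
      (haarProbability G) :=
    integrable_haarProbability_of_continuous (htr.mul hw)
  have h1 : ∫ g, ((M : ℝ) + (σ g).trace.re) * Real.exp (-(β * ((N : ℝ) - (ρ g).trace.re)))
      ∂(haarProbability G) =
      M * (∫ g, Real.exp (-(β * ((N : ℝ) - (ρ g).trace.re))) ∂(haarProbability G)) +
        ∫ g, (σ g).trace.re * Real.exp (-(β * ((N : ℝ) - (ρ g).trace.re))) ∂(haarProbability G) := by
    simp_rw [add_mul]
    rw [integral_add (hwi.const_mul _) htwi, integral_const_mul]
  have h2 : ∫ g, ((M : ℝ) - (σ g).trace.re) * Real.exp (-(β * ((N : ℝ) - (ρ g).trace.re)))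
      ∂(haarProbability G) =
      M * (∫ g, Real.exp (-(β * ((N : ℝ) - (ρ g).trace.re))) ∂(haarProbability G)) -
        ∫ g, (σ g).trace.re * Real.exp (-(β * ((N : ℝ) - (ρ g).trace.re))) ∂(haarProbability G) := by
    simp_rw [sub_mul]
    rw [integral_sub (hwi.const_mul _) htwi, integral_const_mul]
  rw [h1] at hplus
  rw [h2] at hminus
  rw [abs_mul, abs_inv, Nat.abs_cast, ← div_eq_inv_mul, div_lt_iff₀ hMpos, abs_lt]
  constructor <;> linarith

/-- **A NON-TRIVIAL CHARACTER `χ` CONFINES IN EVERY TWO-DIMENSIONAL `ρ`-THEORY.**  For a continuous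
one-dimensional `σ` (a character, automatically of modulus one) with some `σ(g₀) ≠ 1`, every continuous `ρ` and
every real `β`, the `σ`-loops of the `ρ`-theory obey the volume-uniform area law: the scalar `∫ χ w_ρ` is the
real number `∫ Re χ · w_ρ` (inversion symmetry of Haar and of the class weight), and `Re χ(g₀) < 1`. -/
theorem areaLaw_two_of_rep_card_eq_one (σ : G →* Matrix (Fin 1) (Fin 1) ℂ) (hρ : Continuous ρ)
    (hσ : Continuous σ) (hnt : ∃ g₀ : G, σ g₀ ≠ 1) (β : ℝ) :
    ∃ C c_area : ℝ, 0 < c_area ∧ ∀ (L : ℕ) [NeZero L] (x : Site 2 L) (i j : Fin 2) (R T : ℕ), i ≠ j →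
      1 ≤ R → 1 ≤ T → 2 * R ≤ L → 2 * T ≤ L →
        |wilsonExpectation ρ β (wilsonLoop σ x i j R T)| ≤ C ^ (2 * (R + T)) * Real.exp (-c_area * (R * T)) := by
  have htr1 : ∀ A : Matrix (Fin 1) (Fin 1) ℂ, A.trace = A 0 0 := fun A => Matrix.trace_fin_one A
  have hσu : ∀ u : G, (σ u)ᴴ = σ u⁻¹ := fun u => by
    ext i j
    have hi : i = 0 := Subsingleton.elim _ _
    have hj : j = 0 := Subsingleton.elim _ _
    subst hi hj
    have h := CompactGroup.trace_map_inv σ hσ u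
    rw [htr1, htr1] at h
    rw [Matrix.conjTranspose_apply, h, Complex.star_def]
  have hw : Continuous fun g : G => Real.exp (-(β * ((N : ℝ) - (ρ g).trace.re))) := by
    have := Complex.continuous_re.comp hρ.matrix_trace
    fun_prop
  have hwi : ∀ u : G, Real.exp (-(β * ((N : ℝ) - (ρ u⁻¹).trace.re))) =
      Real.exp (-(β * ((N : ℝ) - (ρ u).trace.re))) := fun u => by
    rw [CompactGroup.re_trace_map_inv ρ hρ]
  have hreal := integral_trace_mul_eq_ofReal σ hσ hσu hw hwi
  refine areaLaw_two_of_rep_trace_re_lt ρ σ hρ hσ β ?_ ?_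
  · ext k l
    have hk : k = 0 := Subsingleton.elim _ _
    have hl : l = 0 := Subsingleton.elim _ _
    subst hk hl
    rw [Matrix.of_apply, Matrix.smul_apply, Matrix.one_apply_eq, smul_eq_mul, mul_one]
    simp only [Nat.cast_one, inv_one, one_mul] at hreal ⊢
    rw [← hreal]
    refine integral_congr_ae (ae_of_all _ fun g => ?_)
    beta_reduce
    rw [htr1]
  · obtain ⟨g₀, hg₀⟩ := hnt
    refine ⟨g₀, ?_⟩
    by_contra hge
    push Not at hge
    rw [Nat.cast_one] at hge
    have hnorm : ‖(σ g₀).trace‖ ≤ 1 := by simpa using norm_trace_le_card σ hσ g₀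
    have hre : (σ g₀).trace.re ≤ ‖(σ g₀).trace‖ := Complex.re_le_norm _
    have hsq : ‖(σ g₀).trace‖ ^ 2 = (σ g₀).trace.re ^ 2 + (σ g₀).trace.im ^ 2 := by
      rw [← Complex.normSq_eq_norm_sq, Complex.normSq_apply]; ring
    have him : (σ g₀).trace.im = 0 := by nlinarith [sq_nonneg (σ g₀).trace.im]
    have hone : (σ g₀).trace = 1 := Complex.ext (by simp; linarith) (by simpa using him)
    apply hg₀
    ext i j
    have hi : i = 0 := Subsingleton.elim _ _
    have hj : j = 0 := Subsingleton.elim _ _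
    subst hi hj
    rw [htr1] at hone
    rw [hone, Matrix.one_apply_eq]

/-- **EVERY NON-TRIVIAL IRREDUCIBLE `σ` CONFINES IN EVERY TWO-DIMENSIONAL `ρ`-WILSON-ACTION THEORY AT EVERY
COUPLING** (all dimensions `M ≥ 1`): trivial commutant and `σ ≠ 1` suffice. -/
theorem areaLaw_two_of_rep_irreducible' [NeZero M] (hρ : Continuous ρ) (hσ : Continuous σ)
    (hirr : IsIrreducibleFamily fun g : G => σ g) (hnt : ∃ g₀ : G, σ g₀ ≠ 1) (β : ℝ) :
    ∃ C c_area : ℝ, 0 < c_area ∧ ∀ (L : ℕ) [NeZero L] (x : Site 2 L) (i j : Fin 2) (R T : ℕ), i ≠ j →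
      1 ≤ R → 1 ≤ T → 2 * R ≤ L → 2 * T ≤ L →
        |wilsonExpectation ρ β (wilsonLoop σ x i j R T)| ≤ C ^ (2 * (R + T)) * Real.exp (-c_area * (R * T)) := by
  obtain hM1 | hM2 : M = 1 ∨ 2 ≤ M := by have := NeZero.pos M; omega
  · subst hM1
    exact areaLaw_two_of_rep_card_eq_one ρ σ hρ hσ hnt β
  · exact areaLaw_two_of_rep_irreducible ρ σ hM2 hρ hσ hirr β

end General

end Summit.Ventures.LatticeQCDFlow.Scoring
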